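import Literature.AlgebraicGeometry.Resolution.ExceptionalDivisorProjectiveBundle
import Literature.AlgebraicGeometry.Resolution.CohenMacaulaySystemsOfParameters
import Literature.AlgebraicGeometry.Resolution.RegularCentreBlowupOrder
import Literature.AlgebraicGeometry.Resolution.BlowupStalkCharts
import HarnessLib

/-!
# [OURS · L1 W4.5(b) · EL♮] T-FIBRE: blowing up a regular surface germ `D` in an `𝔪`-primary
# (non-Cartier) ideal has a CURVE as fibre over the point — the whole exceptional `ℙ¹`

HONEST FRAMING. OURS (cell res-hironaka, crux chain w45b, slot W4.5(b)); NOT a statement of any manuscript;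
AI-written, weaker than expert review. Helper `--supports stmt-ResolutionOfSingularities-20038 --as helper`
(crux `EquisingularLiftNat`, research stub `stub_elnat_three_isolated` of res-L1-w45b-lead-2's skeleton v3).
Typed target **T-FIBRE** of `L/res-L1-w45b-lead-2/LEAD-MEMO-2.md` §1/§4 (res-L1-w45b-lead-2 NAMING
2026-08-27T06:32:06Z: «D regular 2-dim local, I ⊂ 𝔪_D an ideal of height 2 (𝔪-primary) ⇒ the fibre of
Bl_I D over the closed point is 1-dimensional (analytic spread 2) — enough: Proj(⊕ Iⁿ/𝔪Iⁿ) has positive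
dimension, or the concrete case I = (ϖ^v, ℓ) / I = 𝔪»). Role in the memo (§1 FACT, by hand there): after a
section `s_q` at a SINGULAR point `q` of `Γ = D_k`, the strict transform `St_{s_q}(D) = Bl_{D ∩ s_q}(D)`
of a regular `O`-model `D` contains the whole fibre `e_q` of the exceptional divisor over `q`, because
`D ∩ s_q ⊂ D` is `𝔪_q`-primary of height `2`, never Cartier; hence E1 for later centres along `Γ′` needs
`e_q ⊆ H_{i+1}` (H-CONE), i.e. «section-first at a dilemma point is fatal». This file supplies the local
algebra and the blow-up statement in the tree's currencies; the identification of the curve found here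
with `e_q ≅ ℙ¹_k` inside the ambient `Bl_{s_q}(P)` is left to the consumer (it is the closed immersion
`Bl_{(a,b)}(D) ↪ ℙ¹_D ↪ ℙ¹_P` of §3).

WHAT IS PROVED (all [folklore]-level commutative algebra / Hartshorne II 8.24 (b), assembled from the tree's
`Literature/AlgebraicGeometry/Resolution` library; axioms standard; no `def`s).

§1 `isQuasiRegular_of_isSystemOfParameters`, `isQuasiRegular_of_radical_isMaximal`, `isQuasiRegular_pair`,
   `radical_span_pow_eq` — a system of parameters of a Cohen–Macaulay (e.g. regular) local ring is a
   QUASI-REGULAR sequence (Matsumura 17.4 (iii) + 16.2 (i), tree `isWeaklyRegular_of_isSystemOfParameters`,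
   `isQuasiRegular_of_isWeaklyRegular`); in dimension `2`: any `a, b` with `rad (a, b) = 𝔪`, e.g.
   `(a, b) = 𝔪` or `(ϖ^v, ℓ)`, `v ≥ 1`, for regular parameters `(ϖ, ℓ)`.
§2 `coeff_mem_of_eval_mem_mul_pow` (ANALYTIC INDEPENDENCE, Northcott–Rees / Matsumura 14.5): `x`
   quasi-regular, `(x) ⊆ K`, `F` a form of degree `n` with `F(x) ∈ K·(x)ⁿ` ⇒ the coefficients of `F` lie in
   `K`; with `K = 𝔪`: **the fibre cone `⊕ Iⁿ/𝔪Iⁿ` of `I = (s)`, `s` a system of parameters of a CM /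
   regular local ring, is the polynomial ring `k[T₁, …, T_d]`** (`coeff_mem_maximalIdeal_of_eval_mem`,
   `…_of_isRegularLocalRing`) — so `Proj` of it, the closed fibre of `Bl_I`, is `ℙ^{d−1}_k` («analytic
   spread `d`»).
§3 AFFINE MODEL `π : Bl_{(c)}(Spec R) = Proj R[(c)t] → Spec R`, `R` local, `c = (c₀, …, c_r)` quasi-regular
   with `rad (c) = 𝔪`: `range_specMap_quotientMk_eq` (`V(c) = {𝔪}`), `preimage_closedPoint_eq_range_fst`
   (the closed fibre is the exceptional divisor `E = Bl ×_R Spec R/(c)` as a set),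
   **`range_exceptional_toProj_eq` / `image_preimage_closedPoint_eq`: under the closed immersion
   `Bl ↪ ℙʳ_R` (`T_j ↦ c_j t`) the closed fibre `π⁻¹(𝔪)` maps ONTO the whole fibre `ℙʳ_k` of `ℙʳ_R` over
   the closed point** (from the tree's `isPullback_exceptional_projectiveSpace`: `E ≅ ℙʳ_{R/(c)}`).
§4 `IsBlowup` CURRENCY (any blowing up `π : X' → X` along `J`, universal property of `Blowups.lean`):
   `exists_blowupChart_preimmersion` (the charts `Spec 𝒪_{X,y}[J_y/c_j] → X'` are preimmersions),
   **`exists_specializes_ne_of_isQuasiRegular`**: `J_y = (c₀, …, c_{r+1})` quasi-regular in `𝔪_y` (≥ 2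
   members) ⇒ `π⁻¹(y)` contains two DISTINCT points `x₁ ⤳ x₀` (positive-dimensional fibre — the currency of
   `…EquisingularLiftNatCarrierRigidity`); **`exists_specializes_ne_of_isRegularLocalRing`** (`𝒪_{X,y}`
   regular of dimension `d ≥ 2`, `J_y` generated by `d` elements with `rad J_y = 𝔪_y`) and
   **`exists_specializes_ne_of_surface`** (T-FIBRE as printed: `dim 𝒪_{X,y} = 2`, `J_y = (a, b)`,
   `rad (a, b) = 𝔪_y`).

LIMITS. (i) The centre must be generated at `y` by `dim 𝒪_{X,y}` elements (true for the trace `D ∩ s_q` of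
a section: two generators); for an `𝔪`-primary `J_y` needing more generators the conclusion still holds
(analytic spread of an `𝔪`-primary ideal = `dim`), a theorem not in the tree and not proved here. (ii) §4
gives «positive-dimensional», §3 «all of `ℙʳ`» for the affine model; that the curve of §4 is the whole
ambient `e_q` needs the consumer's identification of `e_q`. (iii) Companion: where `J·𝒪_D` IS invertible,
`St(D) ≅ D` (`…EquisingularLiftNatStrictTransformCentre` rev 2). Grading instances: `letI := MvPolynomial.gradedAlgebra`.

References: H. Matsumura, *Commutative Ring Theory*, CUP 1986, Thms. 14.5, 16.2, 17.4, 17.8 [Matsumura1987];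
R. Hartshorne, *Algebraic Geometry*, GTM 52, II Thm. 8.24 (b) [Hartshorne1977]; The Stacks Project, Tags
0804, 0805, 0BIQ [StacksProject] — all through the cited tree files. OURS planning texts (index only):
`L/res-L1-w45b-lead-2/LEAD-MEMO-2.md` (sha16 1313157f02971342), `L/res-L1-w45b-lead-2/SkeletonELnat-v3.lean`.
-/

set_option linter.dupNamespace false -- mandated namespace `Summit.<Summit>.<Problem>` of this single-conjunct summit

noncomputable section

open CategoryTheory CategoryTheory.Limits AlgebraicGeometry TopologicalSpace IsLocalRing MvPolynomial
open Literature.AlgebraicGeometry.Resolution Literature.RingTheory.TightClosure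

universe u

namespace Summit.ResolutionOfSingularities.ResolutionOfSingularities.Cruxes.EquisingularLiftNat.Sections

/-! ## §1 Systems of parameters of Cohen–Macaulay (e.g. regular) local rings are quasi-regular -/

/-- **A system of parameters of a Cohen–Macaulay local ring is a quasi-regular sequence**: with an
`S`-regular sequence in `𝔪` of length `dim S` (the tree's Cohen–Macaulay clause), every system of parameters
`s` is weakly regular (Matsumura 17.4 (iii), tree `isWeaklyRegular_of_isSystemOfParameters`) hence
quasi-regular (Rees, Matsumura 16.2 (i), tree `isQuasiRegular_of_isWeaklyRegular`).
[cite: Matsumura1987, Thm. 17.4 (iii) and Thm. 16.2 (i)] -/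
theorem isQuasiRegular_of_isSystemOfParameters {S : Type u} [CommRing S] [IsNoetherianRing S]
    [IsLocalRing S] (hCM : ∃ rs : List S, RingTheory.Sequence.IsRegular S rs ∧ (∀ r ∈ rs, r ∈ maximalIdeal S) ∧
      (rs.length : WithBot ℕ∞) = ringKrullDim S)
    {d : ℕ} (s : Fin d → S) (hs : IsSystemOfParameters s) : IsQuasiRegular s :=
  isQuasiRegular_of_isWeaklyRegular s (isWeaklyRegular_of_isSystemOfParameters hCM s hs)

/-- **A system of parameters of a REGULAR local ring is quasi-regular** (regular ⇒ Cohen–Macaulay,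
Matsumura Thm. 17.8, tree `cmClause_of_isRegularLocalRing`): `dim S = d`, `s : Fin d → S` with
`rad (s)` maximal ⇒ `s` is quasi-regular. [cite: Matsumura1987, Thm. 17.8 with Thm. 17.4 (iii), Thm. 16.2 (i)] -/
theorem isQuasiRegular_of_radical_isMaximal {S : Type u} [CommRing S] [IsRegularLocalRing S] {d : ℕ}
    (hd : ringKrullDim S = d) (s : Fin d → S) (hrad : (Ideal.span (Set.range s)).radical.IsMaximal) :
    IsQuasiRegular s :=
  isQuasiRegular_of_isWeaklyRegular s (cmClause_of_isRegularLocalRing S d hd s hrad)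

/-- The two-element case T-FIBRE uses: in a regular local ring of dimension `2`, any `a, b` with
`rad (a, b) = 𝔪` (e.g. `(a, b) = 𝔪`, or `(ϖ^v, ℓ)`, `v ≥ 1`, for regular parameters `(ϖ, ℓ)`) form a
quasi-regular sequence. [cite: Matsumura1987, Thm. 17.8 with Thm. 17.4 (iii), Thm. 16.2 (i)] -/
theorem isQuasiRegular_pair {S : Type u} [CommRing S] [IsRegularLocalRing S]
    (h2 : ringKrullDim S = (2 : ℕ)) (a b : S) (hrad : (Ideal.span {a, b}).radical = maximalIdeal S) :
    IsQuasiRegular ![a, b] := by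
  refine isQuasiRegular_of_radical_isMaximal h2 ![a, b] ?_
  have hr : Set.range ![a, b] = {a, b} := by
    rw [Matrix.range_cons, Matrix.range_cons, Matrix.range_empty, Set.union_empty]; rfl
  rw [hr, hrad]
  exact maximalIdeal.isMaximal S

/-- `rad (ϖ^v, ℓ) = 𝔪` for `v ≥ 1` when `(ϖ, ℓ) = 𝔪`: the ideal `(ϖ^v, ℓ)` of LEAD-MEMO-2 §1 (trace of a
section meeting the regular surface germ `D` with `ϖ`-contact `v`) is `𝔪`-primary. [folklore] -/
theorem radical_span_pow_eq {S : Type u} [CommRing S] [IsLocalRing S] (ϖ ℓ : S)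
    (hm : Ideal.span {ϖ, ℓ} = maximalIdeal S) {v : ℕ} (hv : 1 ≤ v) :
    (Ideal.span {ϖ ^ v, ℓ}).radical = maximalIdeal S := by
  apply le_antisymm
  · rw [← (maximalIdeal.isMaximal S).isPrime.radical]
    apply Ideal.radical_mono
    rw [← hm, Ideal.span_le, Set.insert_subset_iff, Set.singleton_subset_iff]
    exact ⟨Ideal.pow_mem_of_mem _ (Ideal.subset_span (Set.mem_insert ϖ {ℓ})) _ hv,
      Ideal.subset_span (Set.mem_insert_of_mem ϖ rfl)⟩
  · rw [← hm, Ideal.span_le, Set.insert_subset_iff, Set.singleton_subset_iff]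
    exact ⟨⟨v, Ideal.subset_span (Set.mem_insert _ _)⟩,
      Ideal.le_radical (Ideal.subset_span (Set.mem_insert_of_mem _ rfl))⟩

/-! ## §2 Analytic independence: the fibre cone of a quasi-regular ideal is a polynomial ring -/

/-- **Analytic independence from quasi-regularity** (Northcott–Rees; Matsumura Thm. 14.5 for systems of
parameters): `x` quasi-regular, `I = (x) ⊆ K`, `F` a form of degree `n` with `F(x) ∈ K · Iⁿ` ⇒ every
coefficient of `F` lies in `K`; i.e. `gr_I(R) ⊗_R R/K = (R/K)[T]` — for `K = 𝔪` the FIBRE CONE `⊕ Iⁿ/𝔪Iⁿ`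
is `k[T₀, …, T_r]` and the closed fibre of `Bl_I → Spec R` is `ℙʳ_k`. Proof: `F(x) = G(x)` for a form `G`
with coefficients in `K` (tree `exists_isHomogeneous_of_mem_mul_span_pow`); `(F − G)(x) = 0 ∈ I^{n+1}`,
so the coefficients of `F − G` lie in `I ⊆ K`. [cite: Matsumura1987, Thm. 14.5 and §16] -/
theorem coeff_mem_of_eval_mem_mul_pow {R : Type u} [CommRing R] {ι : Type*} {x : ι → R}
    (hx : IsQuasiRegular x) {K : Ideal R} (hK : Ideal.span (Set.range x) ≤ K) {n : ℕ}
    {F : MvPolynomial ι R} (hF : F.IsHomogeneous n)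
    (h : eval x F ∈ K * Ideal.span (Set.range x) ^ n) : ∀ m, F.coeff m ∈ K := by
  obtain ⟨G, hG, hGK, hGF⟩ := exists_isHomogeneous_of_mem_mul_span_pow x K n h
  have hzero : eval x (F - G) ∈ Ideal.span (Set.range x) ^ (n + 1) := by
    rw [map_sub, hGF, sub_self]
    exact zero_mem _
  have hq := (isQuasiRegular_def x).mp hx n (F - G) (hF.sub hG) hzero
  rw [mem_map_C_iff] at hGK
  intro m
  have := add_mem (hK (hq m)) (hGK m)
  rwa [coeff_sub, sub_add_cancel] at this

/-- **T-FIBRE, ring form**: for a system of parameters `s` of a Noetherian local ring with the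
Cohen–Macaulay clause and a form `F` of degree `n`, `F(s) ∈ 𝔪 · (s)ⁿ` ⇒ all coefficients of `F` lie in
`𝔪`. Hence `⊕ₙ (s)ⁿ/𝔪(s)ⁿ ≅ k[T₁, …, T_d]` and the closed fibre of `Bl_{(s)}(Spec S) → Spec S` is
`ℙ^{d−1}_k`, all of the exceptional projective space (scheme form: §3). [cite: Matsumura1987, Thm. 14.5] -/
theorem coeff_mem_maximalIdeal_of_eval_mem {S : Type u} [CommRing S] [IsNoetherianRing S]
    [IsLocalRing S] (hCM : ∃ rs : List S, RingTheory.Sequence.IsRegular S rs ∧ (∀ r ∈ rs, r ∈ maximalIdeal S) ∧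
      (rs.length : WithBot ℕ∞) = ringKrullDim S)
    {d : ℕ} (s : Fin d → S) (hs : IsSystemOfParameters s) {n : ℕ} {F : MvPolynomial (Fin d) S}
    (hF : F.IsHomogeneous n) (h : eval s F ∈ maximalIdeal S * Ideal.span (Set.range s) ^ n) :
    ∀ m, F.coeff m ∈ maximalIdeal S :=
  coeff_mem_of_eval_mem_mul_pow (isQuasiRegular_of_isSystemOfParameters hCM s hs)
    (hs.2 ▸ Ideal.le_radical) hF h

/-- **T-FIBRE, ring form, regular local rings**: `dim S = d`, `s : Fin d → S` with `rad (s) = 𝔪`, `F` a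
form of degree `n` with `F(s) ∈ 𝔪 · (s)ⁿ` ⇒ all coefficients of `F` lie in `𝔪`
(`⊕ₙ (s)ⁿ/𝔪(s)ⁿ = k[T₁, …, T_d]`). [cite: Matsumura1987, Thm. 14.5] -/
theorem coeff_mem_maximalIdeal_of_eval_mem_of_isRegularLocalRing {S : Type u} [CommRing S]
    [IsRegularLocalRing S] {d : ℕ} (hd : ringKrullDim S = d) (s : Fin d → S)
    (hrad : (Ideal.span (Set.range s)).radical = maximalIdeal S) {n : ℕ} {F : MvPolynomial (Fin d) S}
    (hF : F.IsHomogeneous n) (h : eval s F ∈ maximalIdeal S * Ideal.span (Set.range s) ^ n) :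
    ∀ m, F.coeff m ∈ maximalIdeal S :=
  coeff_mem_of_eval_mem_mul_pow
    (isQuasiRegular_of_radical_isMaximal hd s (hrad ▸ maximalIdeal.isMaximal S))
    (hrad ▸ Ideal.le_radical) hF h

/-! ## §3 The affine model: the closed fibre of `Bl_{(c)}(Spec R) → Spec R` fills `ℙʳ` over the point -/
section AffineModel

variable {R : Type u} [CommRing R] [IsLocalRing R]

/-- For an `𝔪`-primary ideal `I` of a local ring (`rad I = 𝔪`), the closed immersion
`Spec R/I ↪ Spec R` has image the closed point only: `V(I) = {𝔪}`. [folklore] -/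
theorem range_specMap_quotientMk_eq (I : Ideal R) (hrad : I.radical = maximalIdeal R) :
    Set.range (Spec.map (CommRingCat.ofHom (Ideal.Quotient.mk I))) = {closedPoint R} := by
  have hI : I ≤ maximalIdeal R := hrad ▸ Ideal.le_radical
  ext p
  constructor
  · rintro ⟨q, rfl⟩
    apply PrimeSpectrum.ext
    have hle : I ≤ (Spec.map (CommRingCat.ofHom (Ideal.Quotient.mk I)) q).asIdeal := by
      intro a ha
      rw [Spec.map_apply, CommRingCat.hom_ofHom, PrimeSpectrum.comap_asIdeal, Ideal.mem_comap,
        Ideal.Quotient.eq_zero_iff_mem.mpr ha]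
      exact zero_mem _
    exact le_antisymm (IsLocalRing.le_maximalIdeal (PrimeSpectrum.isPrime _).ne_top)
      (hrad.symm.trans_le ((Ideal.radical_mono hle).trans_eq (PrimeSpectrum.isPrime _).radical))
  · intro hp
    obtain rfl : p = closedPoint R := hp
    haveI : ((maximalIdeal R).map (Ideal.Quotient.mk I)).IsPrime :=
      Ideal.map_isPrime_of_surjective Ideal.Quotient.mk_surjective (by rwa [Ideal.mk_ker])
    refine ⟨⟨(maximalIdeal R).map (Ideal.Quotient.mk I), inferInstance⟩, ?_⟩
    apply PrimeSpectrum.ext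
    rw [Spec.map_apply, CommRingCat.hom_ofHom, PrimeSpectrum.comap_asIdeal,
      Ideal.comap_map_of_surjective _ Ideal.Quotient.mk_surjective, ← RingHom.ker_eq_comap_bot,
      Ideal.mk_ker, sup_eq_left.mpr hI]
    rfl

variable {r : ℕ} (c : Fin (r + 1) → R)

local notation3 "𝓘" => Ideal.span (Set.range c)
local notation3 "jc" => Spec.map (CommRingCat.ofHom (Ideal.Quotient.mk (Ideal.span (Set.range c))))

omit [IsLocalRing R] in
/-- The kernel of `Spec R/(c) ↪ Spec R` is the ideal sheaf of `(c)` (the hypothesis `hj` of the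
tree's `isPullback_exceptional_projectiveSpace`). [folklore] -/
theorem ker_specMap_quotientMk_span :
    (Spec.map (CommRingCat.ofHom (Ideal.Quotient.mk 𝓘))).ker = affineBlowup.idealSheaf 𝓘 := by
  rw [ker_specMap_eq_idealSheaf, Ideal.mk_ker]

/-- **The closed fibre IS the exceptional divisor** for an `𝔪`-primary centre: if `rad (c) = 𝔪`
then the fibre of `π : Bl_{(c)}(Spec R) → Spec R` over the closed point is (the image of) the whole
exceptional divisor `E = Bl ×_{Spec R} Spec R/(c)`. [folklore] -/
theorem preimage_closedPoint_eq_range_fst (hrad : (𝓘).radical = maximalIdeal R) :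
    affineBlowup.π 𝓘 ⁻¹' {closedPoint R} = Set.range (pullback.fst (affineBlowup.π 𝓘) jc) := by
  rw [Scheme.Pullback.range_fst, range_specMap_quotientMk_eq _ hrad]

/-- **T-FIBRE, affine model.** Let `c = (c₀, …, c_r)` be a quasi-regular sequence of the local ring
`R` generating an `𝔪`-primary ideal (`rad (c) = 𝔪`; e.g. a system of parameters of a regular or
Cohen–Macaulay local ring, §1). Then the exceptional divisor `E` of `π : Bl_{(c)}(Spec R) → Spec R`,
mapped to `ℙʳ_R = Proj R[T₀, …, T_r]` through the closed immersion `Bl ↪ ℙʳ_R` (`T_j ↦ c_j t`), has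
image EXACTLY the whole fibre of `ℙʳ_R → Spec R` over the closed point: `E ≅ ℙʳ_{R/(c)}` (Hartshorne II
8.24 (b), tree `isPullback_exceptional_projectiveSpace`) and `V(c) = {𝔪}`. In words: the closed fibre of
the blowing up of an `𝔪`-primary quasi-regular ideal is ALL of `ℙʳ_k` — it has dimension `r`; it is
not a point as soon as `r ≥ 1`, i.e. as soon as the centre is not Cartier.
[cite: Hartshorne1977, II Thm. 8.24 (b)] -/
theorem range_exceptional_toProj_eq (hc : IsQuasiRegular c) (hrad : (𝓘).radical = maximalIdeal R) :
    letI := MvPolynomial.gradedAlgebra (σ := Fin (r + 1)) (R := R)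
    Set.range (pullback.fst (affineBlowup.π 𝓘) jc ≫
        Proj.map (reesPresentation c) (irrelevant_le_map_reesPresentation c)) =
      Literature.AlgebraicGeometry.Motives.ProjBaseChangeRing.projToSpec (Fin (r + 1)) R ⁻¹'
        {closedPoint R} := by
  letI := MvPolynomial.gradedAlgebra (σ := Fin (r + 1)) (R := R)
  haveI : IsClosedImmersion jc :=
    IsClosedImmersion.spec_of_surjective _ Ideal.Quotient.mk_surjective
  have H := isPullback_exceptional_projectiveSpace c jc (ker_specMap_quotientMk_span c) hc
  ext z
  constructor
  · rintro ⟨w, rfl⟩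
    rw [Set.mem_preimage, ← Scheme.Hom.comp_apply, H.w, Scheme.Hom.comp_apply,
      ← range_specMap_quotientMk_eq _ hrad]
    exact ⟨_, rfl⟩
  · intro hz
    rw [Set.mem_preimage, ← range_specMap_quotientMk_eq (Ideal.span (Set.range c)) hrad] at hz
    obtain ⟨t, ht⟩ := hz
    obtain ⟨w, hw, -⟩ := Scheme.Pullback.exists_preimage_pullback z t ht.symm
    refine ⟨H.isoPullback.inv w, ?_⟩
    rw [← Scheme.Hom.comp_apply, H.isoPullback_inv_fst, hw]

/-- **T-FIBRE, affine model, fibre form**: under the closed immersion `Bl_{(c)}(Spec R) ↪ ℙʳ_R` the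
closed fibre `π⁻¹(𝔪)` maps ONTO the whole fibre `ℙʳ_k` of `ℙʳ_R` over the closed point (`c`
quasi-regular, `rad (c) = 𝔪`). For a regular surface germ (`dim R = 2`, `r = 1`) blown up in an
`𝔪`-primary ideal `(a, b)`: the fibre over the point is the whole exceptional `ℙ¹`.
[cite: Hartshorne1977, II Thm. 8.24 (b)] -/
theorem image_preimage_closedPoint_eq (hc : IsQuasiRegular c) (hrad : (𝓘).radical = maximalIdeal R) :
    letI := MvPolynomial.gradedAlgebra (σ := Fin (r + 1)) (R := R)
    Proj.map (reesPresentation c) (irrelevant_le_map_reesPresentation c) ''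
        (affineBlowup.π 𝓘 ⁻¹' {closedPoint R}) =
      Literature.AlgebraicGeometry.Motives.ProjBaseChangeRing.projToSpec (Fin (r + 1)) R ⁻¹'
        {closedPoint R} := by
  letI := MvPolynomial.gradedAlgebra (σ := Fin (r + 1)) (R := R)
  rw [preimage_closedPoint_eq_range_fst c hrad, ← Set.range_comp, ← range_exceptional_toProj_eq c hc hrad]
  rfl

end AffineModel

/-! ## §4 Blowing ups `IsBlowup π J`: an `𝔪`-primary non-principal quasi-regular centre has a curve as fibre -/

section Global

open Scheme.IdealSheafData

variable {X' X : Scheme.{u}} {π : X' ⟶ X} {J : X.IdealSheafData}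

/-- **Charts of a blowing up through `Spec 𝒪_{X,s}` are PREIMMERSIONS.** For a blowing up `π : X' → X`
along `J` and generators `c` of `J_s`, the chart `Spec 𝒪_{X,s}[J_s/c_j] → X'` (tree
`IsBlowup.exists_chart_morphism_of_index`: `X' ×_X Spec 𝒪_{X,s} ≅ Proj 𝒪_{X,s}[J_s t] ⊇ D₊(c_j t)`) is an
open immersion into `X' ×_X Spec 𝒪_{X,s}` followed by the base change of the preimmersion
`Spec 𝒪_{X,s} → X`, hence a preimmersion — in particular a topological embedding (injective, and
specialisations are read off in the chart). [cite: StacksProject, Tag 0804 and Tag 0805] -/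
theorem exists_blowupChart_preimmersion (hπ : IsBlowup π J) (s : X) {m : ℕ}
    (c : Fin m → X.presheaf.stalk s) (hc : Ideal.span (Set.range c) = stalkIdeal J s) (j : Fin m) :
    ∃ q : Spec (.of (chartRing c j)) ⟶ X', IsPreimmersion q ∧
        q ≫ π = Spec.map (CommRingCat.ofHom (chartBase c j)) ≫ X.fromSpecStalk s := by
  classical
  have hcj : ∀ j, c j ∈ Ideal.span (Set.range c) := fun j =>
    Ideal.mem_span_range_self (f := c) (x := j)
  haveI : Flat (X.fromSpecStalk s) := flat_fromSpecStalk X s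
  have hP : IsBlowup (pullback.snd π (X.fromSpecStalk s))
      (affineBlowup.idealSheaf (Ideal.span (Set.range c))) := by
    have h := hπ.pullback_snd_of_flat (X.fromSpecStalk s)
    rwa [comap_fromSpecStalk_eq_affineBlowupIdealSheaf, ← hc] at h
  obtain ⟨e, he, -⟩ := (affineBlowup.isBlowup (Ideal.span (Set.range c))).unique hP
  refine ⟨(affineBlowup.chartι (c j) (hcj j) ≫ e.hom) ≫ pullback.fst π (X.fromSpecStalk s),
    inferInstance, ?_⟩
  rw [Category.assoc, pullback.condition, Category.assoc, reassoc_of% he, ← Category.assoc,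
    affineBlowup.chartι_π (c j) (hcj j)]

/-- **T-FIBRE for blowing ups (`IsBlowup` currency): an `𝔪`-primary quasi-regular centre with at least
two generators has a POSITIVE-DIMENSIONAL fibre.** Let `π : X' → X` be a blowing up along `J`, `y ∈ X`,
and suppose `J_y = (c₀, …, c_{r+1})` for a quasi-regular sequence `c` of `𝒪_{X,y}` lying in `𝔪_y`
(at least two members). Then the fibre `π⁻¹(y)` contains two DISTINCT points `x₁ ⤳ x₀` — the images of
the primes `𝔪_y B ⊊ 𝔪_y B + (c₁/c₀)` of the chart `B = 𝒪_{X,y}[J_y/c₀]`, whose reduction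
`B/𝔪_y B ≅ κ(y)[T₁, …, T_{r+1}]` is a polynomial ring in `r + 1 ≥ 1` variables (tree
`exists_chartResidueMap`, Stacks 0BIQ). This is the «positive-dimensional special fibre» currency of
the carrier-rigidity helper (`…EquisingularLiftNatCarrierRigidity`). [cite: StacksProject, Tag 0804 and Tag 0BIQ] -/
theorem exists_specializes_ne_of_isQuasiRegular (hπ : IsBlowup π J) (y : X) {r : ℕ}
    (c : Fin (r + 2) → X.presheaf.stalk y) (hc : Ideal.span (Set.range c) = stalkIdeal J y)
    (hcq : IsQuasiRegular c) (hcm : ∀ l, c l ∈ maximalIdeal (X.presheaf.stalk y)) :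
    ∃ x₁ x₀ : X', π x₁ = y ∧ π x₀ = y ∧ x₁ ≠ x₀ ∧ x₁ ⤳ x₀ := by
  classical
  obtain ⟨q, hq, hsq⟩ := exists_blowupChart_preimmersion hπ y c hc 0
  obtain ⟨ρ, -, hρker, hρF⟩ := exists_chartResidueMap c 0 hcq hcm
  -- the two primes `ker ρ = 𝔪B ⊊ ker (T ↦ 0 ∘ ρ)` of the chart ring `B`
  let θ : chartRing c 0 →+* X.presheaf.stalk y ⧸ maximalIdeal (X.presheaf.stalk y) :=
    (MvPolynomial.eval fun _ => 0).comp ρ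
  have hle : RingHom.ker ρ ≤ RingHom.ker θ := fun b hb => by
    rw [RingHom.mem_ker] at hb
    rw [RingHom.mem_ker, RingHom.comp_apply, hb, map_zero]
  have hgen : ρ (chartGen c 0 (Fin.succ 0)) = MvPolynomial.X ⟨Fin.succ 0, Fin.succ_ne_zero 0⟩ := by
    have h := hρF (MvPolynomial.X (Fin.succ 0))
    rw [MvPolynomial.coe_eval₂Hom, MvPolynomial.eval₂_X] at h
    rw [h, MvPolynomial.aeval_X, killVar_of_ne 0 (Fin.succ_ne_zero 0), MvPolynomial.map_X]
  have hne : RingHom.ker ρ ≠ RingHom.ker θ := by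
    intro h
    have hmem : chartGen c 0 (Fin.succ 0) ∈ RingHom.ker θ := by
      rw [RingHom.mem_ker, RingHom.comp_apply, hgen, MvPolynomial.eval_X]
    rw [← h, RingHom.mem_ker, hgen] at hmem
    exact MvPolynomial.X_ne_zero _ hmem
  -- both lie over `𝔪_y`
  have hover : ∀ P : Ideal (chartRing c 0), P.IsPrime → RingHom.ker ρ ≤ P →
      P.comap (chartBase c 0) = maximalIdeal (X.presheaf.stalk y) := by
    intro P hP hP'
    refine ((maximalIdeal.isMaximal _).eq_of_le (Ideal.comap_ne_top _ hP.ne_top) fun a ha => ?_).symm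
    rw [Ideal.mem_comap]
    apply hP'
    rw [hρker]
    exact Ideal.mem_map_of_mem _ ha
  let w₁ : Spec (.of (chartRing c 0)) := ⟨RingHom.ker ρ, RingHom.ker_isPrime ρ⟩
  let w₀ : Spec (.of (chartRing c 0)) := ⟨RingHom.ker θ, RingHom.ker_isPrime θ⟩
  have hw : ∀ w : Spec (.of (chartRing c 0)), RingHom.ker ρ ≤ w.asIdeal → π (q w) = y := by
    intro w hw
    have hw' : Spec.map (CommRingCat.ofHom (chartBase c 0)) w = closedPoint (X.presheaf.stalk y) :=
      PrimeSpectrum.ext (hover w.asIdeal w.isPrime hw)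
    rw [← Scheme.Hom.comp_apply, hsq, Scheme.Hom.comp_apply, hw']
    exact Scheme.fromSpecStalk_closedPoint
  refine ⟨q w₁, q w₀, hw w₁ le_rfl, hw w₀ hle, fun h => hne ?_, ?_⟩
  · exact congrArg PrimeSpectrum.asIdeal (hq.isEmbedding.injective h)
  · exact ((PrimeSpectrum.le_iff_specializes w₁ w₀).mp hle).map q.continuous

/-- **T-FIBRE (res-L1-w45b-lead-2, LEAD-MEMO-2 §1/§4), regular local rings of any dimension `d ≥ 2`.**
Let `π : X' → X` be a blowing up along `J` and `y ∈ X` a point with `𝒪_{X,y}` REGULAR of dimension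
`d = r + 2 ≥ 2`, at which the centre is `𝔪_y`-PRIMARY and generated by `d` elements:
`J_y = (c₀, …, c_{r+1})`, `rad J_y = 𝔪_y` (so `J_y` is NOT invertible: an invertible ideal has height
`≤ 1 < d`). Then the fibre `π⁻¹(y)` is positive-dimensional: it contains two distinct points `x₁ ⤳ x₀`.
(`c` is a system of parameters, hence quasi-regular, §1; then `exists_specializes_ne_of_isQuasiRegular`.)
Contrast: where `J·𝒪` IS invertible the blowing up is an isomorphism
(`…EquisingularLiftNatStrictTransformCentre`, rev 2).
[cite: Matsumura1987, Thm. 17.8 with Thm. 17.4 (iii)] [cite: StacksProject, Tag 0804 and Tag 0BIQ] -/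
theorem exists_specializes_ne_of_isRegularLocalRing (hπ : IsBlowup π J) (y : X)
    [IsRegularLocalRing (X.presheaf.stalk y)] {r : ℕ}
    (hdim : ringKrullDim (X.presheaf.stalk y) = (r + 2 : ℕ))
    (c : Fin (r + 2) → X.presheaf.stalk y) (hc : Ideal.span (Set.range c) = stalkIdeal J y)
    (hrad : (stalkIdeal J y).radical = maximalIdeal (X.presheaf.stalk y)) :
    ∃ x₁ x₀ : X', π x₁ = y ∧ π x₀ = y ∧ x₁ ≠ x₀ ∧ x₁ ⤳ x₀ := by
  have hrad' : (Ideal.span (Set.range c)).radical = maximalIdeal (X.presheaf.stalk y) := by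
    rw [hc, hrad]
  refine exists_specializes_ne_of_isQuasiRegular hπ y c hc
    (isQuasiRegular_of_radical_isMaximal hdim c (hrad' ▸ maximalIdeal.isMaximal _)) fun l => ?_
  exact hrad' ▸ Ideal.le_radical (Ideal.subset_span ⟨l, rfl⟩)

/-- **T-FIBRE as printed in LEAD-MEMO-2 §1 (regular SURFACE germ, two named generators).** `π : X' → X`
a blowing up along `J`; `y ∈ X` with `𝒪_{X,y}` regular of dimension `2` (a regular surface germ `D`);
`J_y = (a, b)` with `rad (a, b) = 𝔪_y` — the trace `D ∩ s` of a section `s ⊄ D` through `y`, e.g.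
`(a, b) = 𝔪_y` or `(ϖ^v, ℓ)` (`radical_span_pow_eq`) — in particular NOT Cartier. Then the fibre of
`π = Bl_{D ∩ s}(D) → D` over `y` contains two distinct points `x₁ ⤳ x₀`: it is a curve (the whole
exceptional `ℙ¹`, affine model `image_preimage_closedPoint_eq`), not a point.
[cite: StacksProject, Tag 0804 and Tag 0BIQ] -/
theorem exists_specializes_ne_of_surface (hπ : IsBlowup π J) (y : X)
    [IsRegularLocalRing (X.presheaf.stalk y)] (hdim : ringKrullDim (X.presheaf.stalk y) = (2 : ℕ))
    (a b : X.presheaf.stalk y) (hab : Ideal.span {a, b} = stalkIdeal J y)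
    (hrad : (stalkIdeal J y).radical = maximalIdeal (X.presheaf.stalk y)) :
    ∃ x₁ x₀ : X', π x₁ = y ∧ π x₀ = y ∧ x₁ ≠ x₀ ∧ x₁ ⤳ x₀ := by
  have hr : Set.range ![a, b] = {a, b} := by
    rw [Matrix.range_cons, Matrix.range_cons, Matrix.range_empty, Set.union_empty]; rfl
  exact exists_specializes_ne_of_isRegularLocalRing hπ y (r := 0) hdim ![a, b] (by rw [hr, hab]) hrad

end Global

end Summit.ResolutionOfSingularities.ResolutionOfSingularities.Cruxes.EquisingularLiftNat.Sections

end
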